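import Summits.RiemannHypothesis.RiemannHypothesis.Theses.Strip
import HarnessLib

/-!
# The universal tower-killer is at least a zero-free strip (cell rh-split, theory-1 g13, kernel T36 — DEDUP PORT)

(a)-class STANDARD v2 (director-rh g12 (AD1) 2026-08-28T01:26:40Z; lead RULING #426).  In any splitting RH ⟺ A ∧ B, the
piece that kills every TOWER TO THE 1-LINE (off-line zeros with abscissae → 1) implies a zero-free vertical strip
`1 - δ < Re s < 1` — here stated with the TREE notion, route Strip's crux `StripZeroFreeStrip`
(stmt-RiemannHypothesis-0349/10660; ineffective quasi-RH(∃θ), open since 1896), not a private copy.  The only new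
notion is `TowersToOne`; it is identified with the negation of every `QuasiRiemannHypothesis θ`, θ < 1, in the
Mathlib-unfolded form the tree uses.  Also: framing fact 16.0 re-typed (`b_iff_rh_of_a_proved`).  Pure logic plus
Mathlib's `riemannZeta_ne_zero_of_one_le_re`.  Nothing here bears on the truth of RH.
-/

set_option linter.dupNamespace false

noncomputable section

namespace Summit.RiemannHypothesis.RiemannHypothesis.Theorems.Splittings.TowerKillerStrip

open Summit.RiemannHypothesis.RiemannHypothesis.Theses.Strip (StripZeroFreeStrip)

/-- «Towers to the 1-line»: `ζ` has zeros with real part beyond every `θ < 1`. -/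
def TowersToOne : Prop := ∀ θ : ℝ, θ < 1 → ∃ s : ℂ, riemannZeta s = 0 ∧ θ < s.re

/-- `TowersToOne` is the failure of quasi-RH at every abscissa `θ < 1` (quasi-RH(θ) in the Mathlib-unfolded form of
`Literature.NumberTheory.LFunctions.QuasiRiemannHypothesis θ` used by route Strip). -/
theorem towersToOne_iff_not_quasiRH :
    TowersToOne ↔ ∀ θ : ℝ, θ < 1 → ¬ (∀ s : ℂ, riemannZeta s = 0 → θ < s.re → s.re < 1 → False) := by
  refine forall₂_congr fun θ _ ↦ ⟨?_, ?_⟩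
  · rintro ⟨s, hs, hθ⟩ hq
    exact hq s hs hθ (lt_of_not_ge fun h1 ↦ riemannZeta_ne_zero_of_one_le_re h1 hs)
  · intro h
    by_contra hne
    exact h fun s hs hθ _ ↦ hne ⟨s, hs, hθ⟩

/-- The negation of `TowersToOne` is exactly route Strip's crux `StripZeroFreeStrip` (a zero-free vertical strip). -/
theorem not_towersToOne_iff_stripZeroFreeStrip : ¬ TowersToOne ↔ StripZeroFreeStrip := by
  unfold TowersToOne StripZeroFreeStrip
  push Not
  constructor
  · rintro ⟨θ, hθ, hz⟩
    exact ⟨1 - θ, by linarith, fun s hs h1 _ ↦ absurd (hz s hs) (not_le.mpr (by linarith))⟩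
  · rintro ⟨δ, hδ, hz⟩
    refine ⟨1 - δ, by linarith, fun s hs ↦ ?_⟩
    by_contra hlt
    push Not at hlt
    have h1 : s.re < 1 := lt_of_not_ge fun h ↦ riemannZeta_ne_zero_of_one_le_re h hs
    exact hz s hs hlt h1

/-- **The universal tower-killer is at least a zero-free strip.**  Any statement `X` incompatible with towers to
the 1-line implies `StripZeroFreeStrip`. -/
theorem stripZeroFreeStrip_of_kills_towersToOne {X : Prop} (hkill : X → ¬ TowersToOne) (hX : X) :
    StripZeroFreeStrip :=
  not_towersToOne_iff_stripZeroFreeStrip.mp (hkill hX)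

/-- Hence in a splitting `A ∧ B → RH` whose piece `A` kills all towers to the 1-line, `A` itself implies the
zero-free strip: `A` is not provable by known methods unless a zero-free strip is (STANDARD v2: such towers must be
assigned to the RH-implied piece `B`). -/
theorem towerKiller_implies_strip {A B : Prop} (_hsplit : A ∧ B → _root_.RiemannHypothesis)
    (hkill : A → ¬ TowersToOne) : A → StripZeroFreeStrip :=
  fun hA ↦ stripZeroFreeStrip_of_kills_towersToOne hkill hA

/-- Framing fact 16.0 (cell book CANDIDATES-theory §16): if `A` is PROVED, `A ∧ B → RH` and `RH → B` make
`B ↔ RH` a theorem — an (a)-class splitting is «A open + a mechanism for A → RH», never «A proved». -/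
theorem b_iff_rh_of_a_proved {A B : Prop} (hA : A) (hsplit : A ∧ B → _root_.RiemannHypothesis)
    (hB : _root_.RiemannHypothesis → B) : B ↔ _root_.RiemannHypothesis :=
  ⟨fun hb ↦ hsplit ⟨hA, hb⟩, hB⟩

end Summit.RiemannHypothesis.RiemannHypothesis.Theorems.Splittings.TowerKillerStrip

end
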